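import Summits.KontsevichZagierPeriods.Zeta5Search.WedgeDictionaryCornerIdentity
import HarnessLib

/-!
# The `Q`-part of the wedge dictionary holds on the whole corner family, for every partner (cell `pub-zeta5`, P1)

HONEST FRAMING: systematic search; no irrationality claim unless certified.

OUR work (Summit side), P1 seat generation 2. The conjecture `wedgeDictionary` (`WedgeDictionary.lean`) quantifies over the
cellular parameters `a` AND an admissible partner index `j ∈ [1,7]`. On the corner `a = (n,0,n,0,n,n,n,n)` (`b = (n;0⁷)`) every
`j ∈ [1,7]` is admissible as soon as `n ≥ 1`, and by the typer's `Q_part_iff_quadM3` the `Q`-conjunct for any such `j` is equivalent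
to the `j`-free identity `Q(a) = ρ(a)·M₃(b)`, which is `quadM3_bCorner` (`WedgeDictionaryCornerIdentity.lean`). Hence:

* `wedgeDictionary_Q_corner` — for every `n ≥ 1` and every `j ∈ [1,7]` the FIRST CONJUNCT of `wedgeDictionary` holds at
  `a = aCorner n` with partner `j` (a theorem; the second conjunct — the cellular integral — is not touched here).
-/

noncomputable section

open Finset

namespace Summit.KontsevichZagierPeriods.Zeta5Search.WedgeDictionary

open Literature.NumberTheory.Irrationality.BrownZudilin2022 (bOfA QOf)

/-- `Q(a) = ρ(a)·M₃(b(a))` at every corner point (all `n`). -/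
theorem Q_eq_rho_quadM3_corner (n : ℕ) : (QOf (aCorner n) : ℚ) = rhoOf (aCorner n) * quadM3 (bOfA (aCorner n)) := by
  rw [bOfA_aCorner, quadM3_bCorner, QOf_aCorner, rhoOf_aCorner]
  have hf : (n.factorial : ℚ) ≠ 0 := by positivity
  have hf3 : ((3 * n).factorial : ℚ) ≠ 0 := by positivity
  push_cast
  field_simp

/-- **The `Q`-part of `wedgeDictionary` on the corner, for every admissible partner**: for `n ≥ 1` and `j ∈ [1,7]`, with
`b = b(aCorner n)` and `b' = b + e_j`, `Q(a) = ρ(a)·(U(b)W(b') − U(b')W(b))`. -/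
theorem wedgeDictionary_Q_corner (n : ℕ) (hn : 1 ≤ n) {j : ℕ} (hj : j ∈ Icc 1 7) :
    (QOf (aCorner n) : ℚ) = rhoOf (aCorner n) *
      (coeffU (bOfA (aCorner n)) * coeffW (Function.update (bOfA (aCorner n)) j (bOfA (aCorner n) j + 1)) -
        coeffU (Function.update (bOfA (aCorner n)) j (bOfA (aCorner n) j + 1)) * coeffW (bOfA (aCorner n))) := by
  obtain ⟨hreg, hd, _⟩ := region_aCorner n hn
  have hpart : 2 * (bOfA (aCorner n) j + 1) ≤ bOfA (aCorner n) 0 + 1 := by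
    obtain ⟨h1, _⟩ := mem_Icc.1 hj
    rw [bOfA_aCorner]
    simp only [bCorner, show j ≠ 0 by omega, if_false, if_true]
    omega
  exact (Q_part_iff_quadM3 (aCorner n) hj hreg hd hpart).2 (Q_eq_rho_quadM3_corner n)

end Summit.KontsevichZagierPeriods.Zeta5Search.WedgeDictionary
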